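import Mathlib
import Literature.Analysis.FluidPDE.HardSphereCollisionRecord
import Literature.Analysis.FluidPDE.HardSphereTorusMeasure
import Literature.MathematicalPhysics.KineticTheory.HardSphereEuler
import Literature.MathematicalPhysics.KineticTheory.HardSphereEulerProofs
import Literature.MathematicalPhysics.KineticTheory.HardSphereUniformGasShift
import Summits.AtomisticToContinuum.HydrodynamicLimit.Theorems.CollisionIsometryCLTCollisionalTransferLocalityGibbsTranslation
import HarnessLib

/-!
# `OneFlightGossipEngine.OneFlightLayeredChaos` — brick B1: translation invariance of the hard-core uniform position law
(crux stmt-AtomisticToContinuum-14535, line `Sketch`, first-rung reduction; registered stub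
`posGibbsMeasure_one_map_add_const`).

For `n` hard spheres of diameter `ε` on `𝕋³ = UnitAddTorus (Fin 3)` the HARD-CORE UNIFORM position law
`μ = posGibbsMeasure 1 ε n = Z⁻¹ 𝟙[no overlap](x) dx` on `(𝕋³)ⁿ` is invariant under the GLOBAL translation
`T_a : x ↦ (k ↦ x k + a)` of all positions by the same `a ∈ 𝕋³`: `(T_a)_# μ = μ`.

Proof: `T_a` is the right translation by the constant configuration `(a, …, a)` of the compact abelian group
`(𝕋³)ⁿ`, whose Haar (= product Lebesgue) measure is right invariant (`Measure.pi.isAddRightInvariant`,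
`measurePreserving_add_right`); the non-overlap set only involves the differences `x i - x j`, so the density
`Z⁻¹ 𝟙[no overlap]` is `T_a`-invariant (`posWeight_const_add_const` of the tree); and a measure-preserving map
fixing the density fixes the `withDensity` measure (change of variables on `T ⁻¹' s`; the landed, Theses-free
`HemisphereAffineSlaving.map_withDensity_eq_self_of_measurePreserving` of
`Theorems/CollisionIsometryCLTCollisionalTransferLocalityGibbsTranslation.lean`, reused, not restated).

References: H. Spohn, *Large Scale Dynamics of Interacting Particles* (1991), Part I §2.1 (2.2), §2.3
(homogeneous Gibbs states and their invariances) [Spohn1991].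
-/

open scoped ENNReal
open MeasureTheory Set
open Literature.MathematicalPhysics.KineticTheory

namespace Summit.AtomisticToContinuum.HydrodynamicLimit.Theorems.OLC

noncomputable section

/-- **The global translation `x ↦ (k ↦ x k + a)` of a configuration of `n` points of `𝕋³` preserves Lebesgue
(= Haar) measure on `(𝕋³)ⁿ`** (right invariance of the product Haar measure under the constant configuration
`(a, …, a)`). [folklore] -/
theorem volume_measurePreserving_configAddConst (n : ℕ) (a : T3) :
    MeasurePreserving (fun x : Fin n → T3 => fun k => x k + a) volume volume := by
  haveI : (volume : Measure (Fin n → T3)).IsAddRightInvariant :=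
    Measure.pi.isAddRightInvariant (fun _ : Fin n => (volume : Measure T3))
  exact measurePreserving_add_right volume (fun _ : Fin n => a)

/-- **Brick B1 (registered stub `posGibbsMeasure_one_map_add_const`).** The hard-core uniform position law
`posGibbsMeasure 1 ε n = Z⁻¹ 𝟙[no overlap] dx` of `n` hard spheres of diameter `ε` on `𝕋³` is invariant under the
global translation `x ↦ (k ↦ x k + a)` of all positions, for every `a ∈ 𝕋³` (no hypothesis on `ε`, `n`).
[folklore] -/
theorem posGibbsMeasure_one_map_add_const : ∀ (ε : ℝ) (n : ℕ) (a : Literature.MathematicalPhysics.KineticTheory.T3), MeasureTheory.Measure.map (fun x : Fin n → Literature.MathematicalPhysics.KineticTheory.T3 => fun k => x k + a) (Literature.MathematicalPhysics.KineticTheory.posGibbsMeasure (fun _ => (1 : ℝ)) ε n) = Literature.MathematicalPhysics.KineticTheory.posGibbsMeasure (fun _ => (1 : ℝ)) ε n := by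
  intro ε n a
  unfold posGibbsMeasure
  refine HemisphereAffineSlaving.map_withDensity_eq_self_of_measurePreserving
    (volume_measurePreserving_configAddConst n a)
    (measurable_const.mul (measurable_posWeight continuous_const ε n)).ennreal_ofReal fun x => ?_
  have hx : (fun k => x k + a) = x + fun _ : Fin n => a := rfl
  rw [hx, posWeight_const_add_const]

end

end Summit.AtomisticToContinuum.HydrodynamicLimit.Theorems.OLC
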